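import Mathlib
import HarnessLib
import Literature.Computability.AlgebraicComplexity.NilCoxeterTensor
import Summits.MatrixMultiplication.MatrixMultiplication.Theses.NilCoxeterShadow
import Summits.MatrixMultiplication.MatrixMultiplication.Theorems.NilCoxeterShadowAThesisStubFlatteningFloor
import Summits.MatrixMultiplication.MatrixMultiplication.Theorems.NilCoxeterShadowAThesisOfInductiveCosetGrowth

/-!
# Crux `AThesis` (stmt-MatrixMultiplication-0956) — `Lines/birth.lean`, skeleton after wave 1 (lead rev 2)

Route `NilCoxeterShadow` (route-MatrixMultiplication-NilCoxeterShadow, REFUTATION line: `closes :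
AThesis → DegenerationTransfer → OmegaTwoGroupAlgebraRank → ¬ MatrixMultiplication`, the two supports
proved, so `AThesis` is the route's one open load-bearing leaf — re-audit bin HONEST-BET-1LEAF).

The crux, with `b n := bR(T_{NC_n}) = algBorderRank (nilCoxeterTensor ℂ n)` (border rank over `ℂ[ε]`,
Bläser 2013 Def 6.1, of the structure tensor of the nil-Coxeter algebra `NC_n = gr ℂ[S_n]`; the route
file inlines `nilCoxeterTensor` verbatim, bridge `nilCoxeterTensor_eq` is `rfl`):

  `AThesis : ∃ δ > 0, ∀ n₀, ∃ n ≥ n₀, (n!)^(1+δ) ≤ b n`   (super-polynomial border rank, infinitely often).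

THE LINE = the route's own declared engine, INDUCTION ALONG THE PARABOLIC TOWER `NC_n ⊂ NC_{n+1}`
(route header, RANKED CRUXES rank 2: "InductiveCosetGrowth … implies X_NC"), made kernel-checked.

State after the lead's wave 1 (2026-08-17):
* `stub_flatteningFloor : ∀ n, n! ≤ b n` — CLOSED, landed as
  `Theorems/NilCoxeterShadowAThesisStubFlatteningFloor.lean` (p146195): conciseness of the unital algebra
  `NC_n` in the output slot + the slice bound for border rank over `ℂ[ε]`.
* glue `aThesis_of_inductiveCosetGrowth : InductiveCosetGrowth → AThesis` — CLOSED, landed as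
  `Theorems/NilCoxeterShadowAThesisOfInductiveCosetGrowth.lean` (p147646): the accumulation lemma
  `exists_superpolynomial_of_growth` (multiplicative steps `(n+1)^(1+δ)` from `n₀` on, started at
  `1 ≤ b n₀`, give `(n!)^(1+δ/2) ≤ b n` infinitely often) + positivity `T_{NC_n} ≠ 0`; as the skeleton vet
  observed, the floor's strength `n!` is not needed for the composition (only `1 ≤ b n₀`).
* `stub_inductiveCosetGrowth : InductiveCosetGrowth` — OPEN, the route item stmt-MatrixMultiplication-0958 BY
  NAME (rank 2, XL, conjecture-grade): `∃ δ > 0, ∃ n₀, ∀ n ≥ n₀, (n+1)^(1+δ) · b n ≤ b (n+1)`. It is the ONLY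
  `sorry` of this file and the whole remaining content of the line: it asks for a super-linear border-rank
  lower bound on an explicit tensor at every level, beyond `Literature.Barriers.MatrixMultiplication.
  LinearRankMethodBarrier` (flattenings / Koszul–Young flattenings certify < 2·dim); false if `ω = 2`
  (`closes` + the landed supports). What IS free along the tower is now in the tree
  (`Literature/Computability/AlgebraicComplexity/NilCoxeterParabolic.lean`, p150662): restricting the left
  factor of `T_{NC_{n+1}}` to `S_n ⊂ S_{n+1}` gives exactly `n+1` block-diagonal copies of `T_{NC_n}`
  (`nilCoxeterTensor_parabolic`; minimal-length coset representatives, lengths add,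
  `inversionNumber_parabolic`), so `b (n+1) ≥ bR((n+1) ⊙ T_{NC_n}) ≥ b n`
  (`algBorderRank_parabolicCopies_le`, `algBorderRank_nilCoxeterTensor_mono`); the factor `(n+1)` itself
  already needs border-rank additivity of copies (false in general, Schönhage), and the `(n+1)^δ` excess must
  come from the off-parabolic part `x ∉ S_n`. Kill criterion, also in the tree (p149965):
  `PolynomialExcess → ¬ AThesis` and `→ ¬ InductiveCosetGrowth`
  (`Theorems/AThesis/Negative/AThesisFalseOfPolynomialExcess.lean`).
* `AThesis_of : AThesis` — THE skeleton theorem: the crux BY NAME = glue (stub 2).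

Honest status. Stub 2 is STRONGER than the crux (uniform gain at every large `n` vs a super-polynomial total
infinitely often); the line certifies "0958 ⟹ 0956" (now in the tree) and isolates the analytic seam, it does
not make `AThesis` easier than 0958. Disproof used: none exists for this crux (`ledger crux ls`, 2026-08-17:
Lines/birth.*, PICKED.md only). Kill inherited from the route: `PolynomialExcess` (stmt-0960) refutes stub 2
and the crux together; `ω = 2` refutes both via `closes`. Algebra-level semisimple degenerations with small
blocks cannot give `PolynomialExcess`: #blocks ≤ dim Z(NC_n) = 1,2,3,5,7,12,16,26 (n = 1..8, lead computation).
-/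

-- `Summit.<Summit>.<Problem>`: for the single-conjunct summit the duplicate component is mandated.
set_option linter.dupNamespace false

namespace Summit.MatrixMultiplication.MatrixMultiplication.Cruxes.AThesis.Birth

open Literature.Computability.AlgebraicComplexity
open Summit.MatrixMultiplication.MatrixMultiplication.Theses.NilCoxeterShadow

/-! ## The stubs -/

/-- **Stub 1 — the flattening floor `n! ≤ bR(T_{NC_n})`** — CLOSED (p146195): re-exported from the landed
helper file so that the skeleton keeps its registered name. [cite: Blaser2013, Lemma 7.1(2) (proof)] -/
theorem stub_flatteningFloor :
    ∀ n : ℕ, n.factorial ≤ algBorderRank (nilCoxeterTensor ℂ n) :=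
  Summit.MatrixMultiplication.MatrixMultiplication.Theorems.AThesis.stub_flatteningFloor

/-- **Stub 2 — the inductive engine, route item `InductiveCosetGrowth` (stmt-MatrixMultiplication-0958) BY
NAME:** `∃ δ > 0, ∃ n₀, ∀ n ≥ n₀, (n+1)^(1+δ) · bR(T_{NC_n}) ≤ bR(T_{NC_{n+1}})` — along the parabolic
decomposition `NC_{n+1} = ⊕_c NC_n · T_c` each coset layer should add strictly more than its dimension share.
Why plausibly true: it is the route's bet (rank 2); false if `ω = 2`. Size XL / open — needs a super-linear
border-rank lower-bound mechanism (border substitution / border apolarity iterated along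
`Rad^k = span{T_w : inv w ≥ k}` with the grading torus), beyond the linear-rank-method barrier.
Sources: card nilcoxeter-shadow §What it needs (3); LandsbergMichalek2018; EfremenkoGargOliveiraWigderson2018. -/
theorem stub_inductiveCosetGrowth : InductiveCosetGrowth := by
  sorry

/-! ## The composition: the crux BY NAME -/

/-- **THE SKELETON THEOREM.** The crux `Summit.MatrixMultiplication.MatrixMultiplication.Theses.NilCoxeterShadow.AThesis`
(stmt-MatrixMultiplication-0956), concluded BY NAME from the one open stub `stub_inductiveCosetGrowth` through
the landed glue `aThesis_of_inductiveCosetGrowth` (p147646; accumulation of multiplicative growth from the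
positivity `1 ≤ bR(T_{NC_{n₀}})`). [folklore] -/
theorem AThesis_of : Summit.MatrixMultiplication.MatrixMultiplication.Theses.NilCoxeterShadow.AThesis :=
  Summit.MatrixMultiplication.MatrixMultiplication.Theorems.AThesis.aThesis_of_inductiveCosetGrowth
    stub_inductiveCosetGrowth

end Summit.MatrixMultiplication.MatrixMultiplication.Cruxes.AThesis.Birth
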